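import Summits.QuantumFields.BalabanUV.T4Continuum.Support.NE7cSmoothingPerformed
import Literature.MathematicalPhysics.QuantumFieldTheory.Balaban1983to89.T4ActivityInterface

/-!
# T⁴ programme, spine node NE7c (U5b) — ROAD P3 «SMOOTHING», the ACTIVITY-LEVEL LETTER LEMMA: Lipschitz-profiled letters
# INSIDE SIGNED multilinear functionals (polymer activities, exponentiated remnants) are two-run Lipschitz with NO floor,
# NO positivity and NO law of the tested variable — and a sharp letter admits no such field

Cell `pub-balaban`, BINDER-OWNERS row NE7c, co-owner #3 = unit `b2b-balaban-t4-ne7c-p3` (GEN 2), skeleton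
`HOME/t4/skeletons/NE7c-t4-ne7c-p3.md` leaf L12 (species table).  Companions: `Spine/NE7cSmoothing` (p206673: the WINDOW's
shell weight, END-W/END-R), `Support/NE7cSmoothingPerformed` (p206897: a profiled letter inside a POSITIVE performed operation —
needs a plateau floor `f`).  THIS MODULE treats the third species of the located question GAPS G-ne7cp2-9 (c1) /
`t4/T4-REF-U5.md` (0.2)–(0.3)(b): background-mediated letters INSIDE SIGNED functionals — the activities `F(X′)` of the
exponentiated cluster expansion ([Balaban1989LargeFieldII] (1.90)–(1.91) p. 388 — TEMPLATE: «where the activities F(X′) are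
defined by» t-integrals of products of operations applied to `∏ V(Y) exp Σ t(Y)V(Y)`) and the exponentiated remnants
`exp Σ_X R′^{(k)}(X)`, `exp Σ_X B′^{(k)}(X)` ((1.98) p. 390, (1.103) p. 391).  There NO positive fibre measure is available: road
P1's anti-concentration (M1) cannot even be STATED for the letter and the performed-letter device (floor `f`) does not apply;
what a SHARP letter would need is the shell's share of the kernel's total VARIATION (§5, typed) — while a Lipschitz PROFILE
makes the letter slot GAUGE-LIPSCHITZ pointwise, by telescoping, constant `L = κ⁻¹`, gauge = the two-run closeness of the
normalised tested values (node U1b / spine estimate NE3's currency).  In the words of `T4ActivityInterface` (verdict (b): «the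
young RATE reduces to TWO named NOT-PRINTED inputs, the interface constant L AND a small slot gauge»): for LETTER slots under
design (η) the constant is the DESIGN's (kernel) and the gauge is NE3's rate BY NAME — neither is a new estimate of row NE7c.

WHAT IS PROVED (kernel; 0 sorry; [folklore] real analysis; NOTHING of Bałaban's asserted — every analytic input a binder):
§1 `abs_prod_profile_sub_le` (`|∏χ_i(a_i) − ∏χ_i(b_i)| ≤ Σ L_i|a_i − b_i|`), `abs_prod_profile_sub_le_of_close` (`≤ Σ L_iρ_i`);
§2 `abs_activity_sub_le` (`|∫(∏χ^A)g dν − ∫(∏χ^B)g dν| ≤ (Σ L_iρ_i)·∫|g|dν` for ANY integrable signed kernel `g`),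
`abs_activity_sub_le_two_kernels` (run-dependent kernels: `+ ∫|g^A − g^B|dν`, the OTHER species — row NE5's — additive);
§3 `letterSlot_abs_le_one` / `letterSlot_lip` (profiled letter slots satisfy the two fields of
`T4ActivityInterface.productInterface`: gauge `L̄|a − b|`, `L̄ ≥ L_i`) and `discrepancy_budget_of_letters` (= pv05's graded budget
`discrepancy_budget_of_interface` on that interface VERBATIM, slot gauges discharged by the closeness of the tested values); §4 `factorLogBound_of_expActivity`, `abs_letterSum_sub_le`,
`factorLogBound_of_letterActivities` (node U5b's currency: exponentiated letter activities ARE a `T4RecentScale.FactorLogBound …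
0 r`, `r_i = Σ_Z M_Z·Σ_{l∈host Z} L_lρ_l`); §5 the dichotomy, typed: `not_lipschitz_smallInd` (a SHARP letter admits NO
Lipschitz field in the tested value), `abs_activity_sub_le_of_shellVariation` (what it needs instead: `∫_{shell}|g| ≤ s·∫|g|`,
an anti-concentration under the VARIATION of a signed kernel — a conditional, supplied by nobody), the design's `linProfile κ` has the field with `L = κ⁻¹`
(`T4LipschitzCutoff.linProfile_lipProfile`); §6 sanity (one letter slot, a NONZERO discrepancy attaining the bound).  NO `def`: theorems only.

HONEST FRAMING.  Road P3's DESIGN (profiles in both runs, identically) is NOT print's procedure (print's letters are sharp,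
[Balaban1988Convergent] (2.17) p. 257); whether profiles extend beyond the live window to letters inside activities is the same
DESIGN QUESTION as for `NE7cSmoothingPerformed` (skeleton §4; U5 referee / node owner) — recorded, not decided here.  The kernel
species `∫|g^A − g^B|` (propagators, backgrounds, couplings at two lattice spacings) is row NE5's / NE3's and is NOT touched.
FIXED finite T⁴, rung (B)+1; NOT infinite volume, NOT a mass gap, NOT Clay, NOT summit progress; spine 0/9.  HONEST DEPENDENCY:
continuum YM on T⁴ ⇐ BetaPertH ∧ nine spine estimates (0/9 proved); BetaPertH ⇐ (D1) ∧ (D4) ∧ CAP+tail; G-an2-4 gates asym, D1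
and NE2/3/4.  ABSOLUTE RULE kept: no cite tag created; equation numbers above are LOCATORS of a TEMPLATE, nothing asserted.
-/

noncomputable section

open MeasureTheory Finset
open scoped BigOperators

namespace Summit.QuantumFields.BalabanUV.T4Continuum.NE7cSmoothingActivity

open Literature.MathematicalPhysics.QuantumFieldTheory.Balaban1983to89
open T4IndicatorShell T4LipschitzCutoff T4LipschitzLedger T4RecentScale T4ActivityInterface B13FamilySum
open Summit.QuantumFields.BalabanUV.T4Continuum.NE7cSmoothingPerformed

/-! ## §1 Pointwise: a product of profiled letters is Lipschitz in the tested values, slot by slot -/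

section Pointwise

variable {k : Type*} {χ : k → ℝ → ℝ} {κ L : k → ℝ}

/-- **TELESCOPING FOR PROFILED LETTERS.**  For Lipschitz cut-off profiles `χ_i` (values in `[0,1]`, constants `L_i`):
`|∏_{i∈s} χ_i(a_i) − ∏_{i∈s} χ_i(b_i)| ≤ Σ_{i∈s} L_i·|a_i − b_i|` (`T4ActivityInterface.abs_prod_sub_prod_le` + the profiles'
Lipschitz fields). [folklore] -/
theorem abs_prod_profile_sub_le (s : Finset k) (hχ : ∀ i ∈ s, LipProfile (χ i) (κ i) (L i)) (a b : k → ℝ) :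
    |∏ i ∈ s, χ i (a i) - ∏ i ∈ s, χ i (b i)| ≤ ∑ i ∈ s, L i * |a i - b i| := by
  have h1 : ∀ i ∈ s, |χ i (a i)| ≤ 1 := fun i hi => by
    rw [abs_of_nonneg ((hχ i hi).nonneg _)]; exact (hχ i hi).le_one _
  have h2 : ∀ i ∈ s, |χ i (b i)| ≤ 1 := fun i hi => by
    rw [abs_of_nonneg ((hχ i hi).nonneg _)]; exact (hχ i hi).le_one _
  refine (T4ActivityInterface.abs_prod_sub_prod_le s (fun i => χ i (a i)) (fun i => χ i (b i)) h1 h2).trans ?_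
  exact Finset.sum_le_sum fun i hi => (hχ i hi).lip _ _

/-- **… WITH THRESHOLDS AND THE TWO-RUN CLOSENESS.**  Tested values `u^A_i`, `u^B_i` with `|u^A_i − u^B_i| ≤ ρ_iθ_i`
(`θ_i > 0`): `|∏ χ_i(u^A_i/θ_i) − ∏ χ_i(u^B_i/θ_i)| ≤ Σ L_iρ_i` — deterministic, no law of `u`, no floor, no sign condition
on anything. [folklore] -/
theorem abs_prod_profile_sub_le_of_close (s : Finset k) (hχ : ∀ i ∈ s, LipProfile (χ i) (κ i) (L i))
    {θ ρ uA uB : k → ℝ} (hθ : ∀ i ∈ s, 0 < θ i) (hclose : ∀ i ∈ s, |uA i - uB i| ≤ ρ i * θ i) :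
    |∏ i ∈ s, χ i (uA i / θ i) - ∏ i ∈ s, χ i (uB i / θ i)| ≤ ∑ i ∈ s, L i * ρ i := by
  have h1 : ∀ i ∈ s, |χ i (uA i / θ i)| ≤ 1 := fun i hi => by
    rw [abs_of_nonneg ((hχ i hi).nonneg _)]; exact (hχ i hi).le_one _
  have h2 : ∀ i ∈ s, |χ i (uB i / θ i)| ≤ 1 := fun i hi => by
    rw [abs_of_nonneg ((hχ i hi).nonneg _)]; exact (hχ i hi).le_one _
  refine (T4ActivityInterface.abs_prod_sub_prod_le s (fun i => χ i (uA i / θ i)) (fun i => χ i (uB i / θ i))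
    h1 h2).trans (Finset.sum_le_sum fun i hi => ?_)
  have h := (hχ i hi).abs_profile_sub_profile_le (hθ i hi) (hclose i hi)
  rwa [mul_div_assoc, div_self (hθ i hi).ne', mul_one] at h

end Pointwise

/-! ## §2 The signed activity: integral of the letter product against an arbitrary integrable kernel -/

section Activity

variable {k X : Type*} [MeasurableSpace X] {ν : Measure X} {χ : k → ℝ → ℝ} {κ L : k → ℝ}

/-- measurability of the letter product. [folklore] -/
theorem measurable_prod_profile (s : Finset k) (hχ : ∀ i ∈ s, LipProfile (χ i) (κ i) (L i)) {θ : k → ℝ}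
    {u : k → X → ℝ} (hu : ∀ i ∈ s, Measurable (u i)) :
    Measurable fun x => ∏ i ∈ s, χ i (u i x / θ i) :=
  Finset.measurable_prod s fun i hi => measurable_profile_comp (hχ i hi) (hu i hi) (θ i)

/-- the letter product takes values in `[0, 1]`. [folklore] -/
theorem prod_profile_mem (s : Finset k) (hχ : ∀ i ∈ s, LipProfile (χ i) (κ i) (L i)) (t : k → ℝ) :
    0 ≤ ∏ i ∈ s, χ i (t i) ∧ ∏ i ∈ s, χ i (t i) ≤ 1 := ⟨Finset.prod_nonneg fun i hi => (hχ i hi).nonneg _,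
  Finset.prod_le_one (fun i hi => (hχ i hi).nonneg _) fun i hi => (hχ i hi).le_one _⟩

/-- integrability of (letter product) × (integrable kernel). [folklore] -/
theorem integrable_prod_profile_mul (s : Finset k) (hχ : ∀ i ∈ s, LipProfile (χ i) (κ i) (L i)) {θ : k → ℝ}
    {u : k → X → ℝ} (hu : ∀ i ∈ s, Measurable (u i)) {g : X → ℝ} (hg : Integrable g ν) :
    Integrable (fun x => (∏ i ∈ s, χ i (u i x / θ i)) * g x) ν :=
  integrable_unitInterval_mul hg (measurable_prod_profile s hχ hu) (fun _ => (prod_profile_mem s hχ _).1)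
    fun _ => (prod_profile_mem s hχ _).2

/-- **THE ACTIVITY-LEVEL LETTER LEMMA (common kernel).**  For ANY integrable signed kernel `g` on the fibre, profiled
letters `χ_i` with thresholds `θ_i > 0`, and tested variables `ρ_iθ_i`-close `ν`-a.e.:
`|∫ (∏χ_i(u^A_i/θ_i))·g dν − ∫ (∏χ_i(u^B_i/θ_i))·g dν| ≤ (Σ_i L_iρ_i) · ∫|g| dν`.  No positivity of `g`, no floor, no law of
`u` — the species where a sharp letter has no device (§5). [folklore] -/
theorem abs_activity_sub_le (s : Finset k) (hχ : ∀ i ∈ s, LipProfile (χ i) (κ i) (L i)) {θ ρ : k → ℝ}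
    (hθ : ∀ i ∈ s, 0 < θ i) {uA uB : k → X → ℝ} (huA : ∀ i ∈ s, Measurable (uA i)) (huB : ∀ i ∈ s, Measurable (uB i))
    {g : X → ℝ} (hg : Integrable g ν) (hclose : ∀ i ∈ s, ∀ᵐ x ∂ν, |uA i x - uB i x| ≤ ρ i * θ i) :
    |(∫ x, (∏ i ∈ s, χ i (uA i x / θ i)) * g x ∂ν) - ∫ x, (∏ i ∈ s, χ i (uB i x / θ i)) * g x ∂ν| ≤
      (∑ i ∈ s, L i * ρ i) * ∫ x, |g x| ∂ν := by
  have hIA := integrable_prod_profile_mul s hχ (θ := θ) huA hg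
  have hIB := integrable_prod_profile_mul s hχ (θ := θ) huB hg
  rw [← integral_sub hIA hIB]
  have hall : ∀ᵐ x ∂ν, ∀ i ∈ s, |uA i x - uB i x| ≤ ρ i * θ i := (ae_ball_iff s.countable_toSet).2 hclose
  calc |∫ x, ((∏ i ∈ s, χ i (uA i x / θ i)) * g x - (∏ i ∈ s, χ i (uB i x / θ i)) * g x) ∂ν|
      ≤ ∫ x, |(∏ i ∈ s, χ i (uA i x / θ i)) * g x - (∏ i ∈ s, χ i (uB i x / θ i)) * g x| ∂ν :=
        abs_integral_le_integral_abs
    _ ≤ ∫ x, (∑ i ∈ s, L i * ρ i) * |g x| ∂ν := by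
        refine integral_mono_ae (hIA.sub hIB).abs (hg.abs.const_mul _) ?_
        filter_upwards [hall] with x hx
        rw [← sub_mul, abs_mul]
        exact mul_le_mul_of_nonneg_right (abs_prod_profile_sub_le_of_close s hχ hθ hx) (abs_nonneg _)
    _ = (∑ i ∈ s, L i * ρ i) * ∫ x, |g x| ∂ν := integral_const_mul _ _

/-- **… WITH RUN-DEPENDENT KERNELS** (the other species enters ADDITIVELY): `|∫(∏χ^A)g^A − ∫(∏χ^B)g^B| ≤
(Σ L_iρ_i)·∫|g^A| + ∫|g^A − g^B|` — the second summand (propagators / backgrounds / couplings of the two lattice spacings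
inside the kernel) is row NE5's / NE3's species, a binder by name, untouched here. [folklore] -/
theorem abs_activity_sub_le_two_kernels (s : Finset k) (hχ : ∀ i ∈ s, LipProfile (χ i) (κ i) (L i)) {θ ρ : k → ℝ}
    (hθ : ∀ i ∈ s, 0 < θ i) {uA uB : k → X → ℝ} (huA : ∀ i ∈ s, Measurable (uA i)) (huB : ∀ i ∈ s, Measurable (uB i))
    {gA gB : X → ℝ} (hgA : Integrable gA ν) (hgB : Integrable gB ν)
    (hclose : ∀ i ∈ s, ∀ᵐ x ∂ν, |uA i x - uB i x| ≤ ρ i * θ i) :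
    |(∫ x, (∏ i ∈ s, χ i (uA i x / θ i)) * gA x ∂ν) - ∫ x, (∏ i ∈ s, χ i (uB i x / θ i)) * gB x ∂ν| ≤
      (∑ i ∈ s, L i * ρ i) * (∫ x, |gA x| ∂ν) + ∫ x, |gA x - gB x| ∂ν := by
  have h1 := abs_activity_sub_le s hχ hθ huA huB hgA hclose
  have hIBA := integrable_prod_profile_mul s hχ (θ := θ) huB hgA
  have hIBB := integrable_prod_profile_mul s hχ (θ := θ) huB hgB
  -- the kernel swap under run B's letters
  have h2 : |(∫ x, (∏ i ∈ s, χ i (uB i x / θ i)) * gA x ∂ν) - ∫ x, (∏ i ∈ s, χ i (uB i x / θ i)) * gB x ∂ν| ≤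
      ∫ x, |gA x - gB x| ∂ν := by
    rw [← integral_sub hIBA hIBB]
    calc |∫ x, ((∏ i ∈ s, χ i (uB i x / θ i)) * gA x - (∏ i ∈ s, χ i (uB i x / θ i)) * gB x) ∂ν|
        ≤ ∫ x, |(∏ i ∈ s, χ i (uB i x / θ i)) * gA x - (∏ i ∈ s, χ i (uB i x / θ i)) * gB x| ∂ν :=
          abs_integral_le_integral_abs
      _ ≤ ∫ x, |gA x - gB x| ∂ν := by
          refine integral_mono_ae (hIBA.sub hIBB).abs (hgA.sub hgB).abs ?_
          filter_upwards with x
          rw [← mul_sub, abs_mul]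
          have hp := prod_profile_mem s hχ (fun i => uB i x / θ i)
          rw [abs_of_nonneg hp.1]
          exact mul_le_of_le_one_left (abs_nonneg _) hp.2
  calc |(∫ x, (∏ i ∈ s, χ i (uA i x / θ i)) * gA x ∂ν) - ∫ x, (∏ i ∈ s, χ i (uB i x / θ i)) * gB x ∂ν|
      ≤ |(∫ x, (∏ i ∈ s, χ i (uA i x / θ i)) * gA x ∂ν) - ∫ x, (∏ i ∈ s, χ i (uB i x / θ i)) * gA x ∂ν| +
          |(∫ x, (∏ i ∈ s, χ i (uB i x / θ i)) * gA x ∂ν) - ∫ x, (∏ i ∈ s, χ i (uB i x / θ i)) * gB x ∂ν| :=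
        abs_sub_le _ _ _
    _ ≤ _ := add_le_add h1 h2

end Activity

/-! ## §3 The interface: profiled LETTER slots form a `T4ActivityInterface.ActivityInterface`; pv05's budget applies verbatim -/

section Interface

variable {Dom Slot Bg : Type*} {χ : Slot → ℝ → ℝ} {κ L : Slot → ℝ} {Lbar : ℝ}

/-- Letter slot functionals are bounded by `1` (first field of `T4ActivityInterface.productInterface`). [folklore] -/
theorem letterSlot_abs_le_one (hχ : ∀ i, LipProfile (χ i) (κ i) (L i)) :
    ∀ (i : Slot) (a : ℝ) (_ω : Bg), a ∈ (Set.univ : Set ℝ) → |χ i a| ≤ 1 := fun i a _ _ => by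
  rw [abs_of_nonneg ((hχ i).nonneg _)]; exact (hχ i).le_one _

/-- Letter slot functionals are `L̄·|a − b|`-Lipschitz for any `L̄ ≥ L_i` (second field of `productInterface`; `L̄ = κ⁻¹` for
`linProfile κ` at every slot). [folklore] -/
theorem letterSlot_lip (hχ : ∀ i, LipProfile (χ i) (κ i) (L i)) (hL : ∀ i, L i ≤ Lbar) :
    ∀ (i : Slot) (a b : ℝ) (_ω : Bg), a ∈ (Set.univ : Set ℝ) → b ∈ (Set.univ : Set ℝ) → |χ i a - χ i b| ≤ Lbar * |a - b| :=
  fun i a b _ _ _ => ((hχ i).lip a b).trans (mul_le_mul_of_nonneg_right (hL i) (abs_nonneg _))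

variable {Cube : Type*} [DecidableEq Dom] [DecidableEq Cube]

/-- **THE LETTER INTERFACE AND pv05's GRADED TWO-RUN BUDGET FOR IT.**  Polymer `Z` hosts letter slots `host Z`; a RUN assigns
to every slot its normalised tested value `t_i = u_i/θ_i` (at the background point where the budget is applied); the activity
is `amp Z ω · ∏_{i∈host Z} χ_i(t_i)` with a COMMON amplitude `‖amp Z ω‖ ≤ A e^{−R d(Z)}`.  These data ARE a
`T4ActivityInterface.productInterface` (all data admissible, gauge `L̄|a − b|`, `L = 1`; its analytic field DISCHARGED by
`letterSlot_abs_le_one` / `letterSlot_lip` — for letter slots the field is the design's, not an estimate), so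
`discrepancy_budget_of_interface` applies VERBATIM: two runs `tA`, `tB` that AGREE off the discrepant sub-catalogue `S` and are
`ρ_i`-close on the slots hosted by `S` (node U1b / NE3's rate read at the letter's level — a binder), (1.26)_rel, the relative
volume bound, the rate condition, an anchor set `Q` with `L̄·Σ_{i∈host Z} ρ_i ≤ e(□)` ⇒
**Σ_{Z∈Λ} ‖amp Z ω·∏χ_i(tA_i) − amp Z ω·∏χ_i(tB_i)‖·e^{τ#out Z + (r₁+s)d(Z) + b} ≤ A e^{b+τc₁}·K₀·Σ_{□∈Q} e(□)**. [folklore] -/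
theorem discrepancy_budget_of_letters {d : Dom → ℝ} {A R : ℝ} (host : Dom → Finset Slot) (amp : Dom → Bg → ℂ)
    (hamp : ∀ Z ω, ‖amp Z ω‖ ≤ A * Real.exp (-(R * d Z))) (hχ : ∀ i, LipProfile (χ i) (κ i) (L i)) (hL0 : 0 ≤ Lbar)
    (hL : ∀ i, L i ≤ Lbar) {Λ S : Finset Dom} (hS : S ⊆ Λ) {out : Dom → Finset Cube} {r₁ s κ₀ K₀ c₁ b τ : ℝ}
    {ρ : Slot → ℝ} {e : Cube → ℝ} (tA tB : Slot → ℝ) (ω : Bg) (hd : ∀ Z, 0 ≤ d Z) (hA : 0 ≤ A) (hτ : 0 ≤ τ)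
    (hagree : ∀ Z ∈ Λ, Z ∉ S → ∀ i ∈ host Z, tA i = tB i) (hclose : ∀ Z ∈ S, ∀ i ∈ host Z, |tA i - tB i| ≤ ρ i)
    (h126 : Ineq126 Λ out d κ₀ K₀) (hvol : VolBound Λ out d c₁) (hrate : κ₀ + (r₁ + s) + τ * c₁ ≤ R)
    {Q : Finset Cube} (he : ∀ q ∈ Q, 0 ≤ e q) (hQ : ∀ Z ∈ S, ∃ q ∈ Q, q ∈ out Z ∧ Lbar * ∑ i ∈ host Z, ρ i ≤ e q) :
    ∑ Z ∈ Λ, ‖amp Z ω * ((∏ i ∈ host Z, χ i (tA i) : ℝ) : ℂ) - amp Z ω * ((∏ i ∈ host Z, χ i (tB i) : ℝ) : ℂ)‖ *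
        Real.exp (τ * ((out Z).card : ℝ) + ((r₁ + s) * d Z + b)) ≤
      A * Real.exp (b + τ * c₁) * K₀ * ∑ q ∈ Q, e q := by
  have hδ : ∀ Z ∈ S, ∀ i ∈ host Z, Lbar * |tA i - tB i| ≤ Lbar * ρ i := fun Z hZ i hi =>
    mul_le_mul_of_nonneg_left (hclose Z hZ i hi) hL0
  have hQ' : ∀ Z ∈ S, ∃ q ∈ Q, q ∈ out Z ∧ (1 : ℝ) * ∑ i ∈ host Z, Lbar * ρ i ≤ e q := fun Z hZ => by
    obtain ⟨q, hq, hqo, hle⟩ := hQ Z hZ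
    exact ⟨q, hq, hqo, by rwa [one_mul, ← Finset.mul_sum]⟩
  exact discrepancy_budget_of_interface
    (productInterface host Set.univ (fun a b => Lbar * |a - b|) (fun a => by simp) (fun Z => A * Real.exp (-(R * d Z)))
      amp hamp (fun i a _ => χ i a) (letterSlot_abs_le_one hχ) (letterSlot_lip hχ hL))
    hS tA tB ω hd hA hτ (fun _ _ _ _ => Set.mem_univ _) (fun _ _ _ _ => Set.mem_univ _) hagree hδ h126 hvol hrate he hQ'

end Interface

/-! ## §4 Node U5b's currency: exponentiated (remnant-type) factors carrying letter activities are `FactorLogBound … 0 r` -/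

section Ledger

variable {ι V : Type*} {Adm : Set V} {fac : Finset ι}

/-- **EXPONENTIATED FACTORS ARE LOG-BOUNDED FACTORS.**  If factor `i` of the two runs' ledgers is `exp F^A_i(v)`,
`exp F^B_i(v)` with `|F^B_i(v) − F^A_i(v)| ≤ r_i` on `Adm`, then `T4RecentScale.FactorLogBound Adm fac … (0) r` — the input
shape of node U5b's `FactorLogBound.sandwich` / `density_sandwich`, constant `0`. [folklore] -/
theorem factorLogBound_of_expActivity {FA FB : ι → V → ℝ} {r : ι → ℝ}
    (h : ∀ v ∈ Adm, ∀ i ∈ fac, |FB i v - FA i v| ≤ r i) :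
    FactorLogBound Adm fac (fun i v => Real.exp (FA i v)) (fun i v => Real.exp (FB i v)) (fun _ => 0) r := by
  intro v hv i hi
  refine ⟨Real.exp_pos _, Real.exp_pos _, ?_⟩
  rw [Real.log_exp, Real.log_exp, sub_zero]
  exact h v hv i hi

variable {Dom Slot : Type*}

/-- **A FINITE SUM OF LETTER ACTIVITIES with common real amplitudes** `|a_Z(v)| ≤ M_Z`: the two runs' sums
`Σ_{Z∈D} a_Z(v)·∏_{l∈host Z} χ_l(t^X_l(v))` differ by at most `Σ_{Z∈D} M_Z·Σ_{l∈host Z} L_l·|t^A_l(v) − t^B_l(v)|`. [folklore] -/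
theorem abs_letterSum_sub_le (D : Finset Dom) (host : Dom → Finset Slot) {χ : Slot → ℝ → ℝ} {κ L : Slot → ℝ}
    (hχ : ∀ l, LipProfile (χ l) (κ l) (L l)) {M : Dom → ℝ} {a : Dom → V → ℝ} (ha : ∀ Z ∈ D, ∀ v, |a Z v| ≤ M Z)
    (tA tB : Slot → V → ℝ) (v : V) :
    |(∑ Z ∈ D, a Z v * ∏ l ∈ host Z, χ l (tA l v)) - ∑ Z ∈ D, a Z v * ∏ l ∈ host Z, χ l (tB l v)| ≤
      ∑ Z ∈ D, M Z * ∑ l ∈ host Z, L l * |tA l v - tB l v| := by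
  rw [← Finset.sum_sub_distrib]
  refine (Finset.abs_sum_le_sum_abs _ _).trans (Finset.sum_le_sum fun Z hZ => ?_)
  rw [← mul_sub, abs_mul]
  exact mul_le_mul (ha Z hZ v) (abs_prod_profile_sub_le (host Z) (fun l _ => hχ l) _ _) (abs_nonneg _)
    ((abs_nonneg _).trans (ha Z hZ v))

/-- **THE LETTER SPECIES OF AN EXPONENTIATED REMNANT, in node U5b's ledger.**  Factor `i` of the term is
`exp(Σ_{Z∈D i} a_{i,Z}(v)·∏_{l∈host Z} χ_l(t^X_l(v)))` in run `X` (COMMON amplitudes `|a_{i,Z}| ≤ M_{i,Z}` — the kernel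
species already matched or booked on row NE5; profiled letters; two-run closeness `|t^A_l − t^B_l| ≤ ρ_l` of the normalised
tested values on `Adm`, node U1b's rate BY NAME) ⇒ `FactorLogBound Adm fac f^A f^B 0 r` with
`r_i = Σ_{Z∈D i} M_{i,Z}·Σ_{l∈host Z} L_lρ_l` — NO floor, NO positivity, NO law of the tested variables. [folklore] -/
theorem factorLogBound_of_letterActivities (D : ι → Finset Dom) (host : Dom → Finset Slot) {χ : Slot → ℝ → ℝ}
    {κ L : Slot → ℝ} (hχ : ∀ l, LipProfile (χ l) (κ l) (L l)) {M : ι → Dom → ℝ} {a : ι → Dom → V → ℝ}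
    (ha : ∀ i ∈ fac, ∀ Z ∈ D i, ∀ v, |a i Z v| ≤ M i Z) {tA tB : Slot → V → ℝ} {ρ : Slot → ℝ}
    (hclose : ∀ v ∈ Adm, ∀ i ∈ fac, ∀ Z ∈ D i, ∀ l ∈ host Z, |tA l v - tB l v| ≤ ρ l) :
    FactorLogBound Adm fac
      (fun i v => Real.exp (∑ Z ∈ D i, a i Z v * ∏ l ∈ host Z, χ l (tA l v)))
      (fun i v => Real.exp (∑ Z ∈ D i, a i Z v * ∏ l ∈ host Z, χ l (tB l v)))
      (fun _ => 0) (fun i => ∑ Z ∈ D i, M i Z * ∑ l ∈ host Z, L l * ρ l) := by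
  refine factorLogBound_of_expActivity fun v hv i hi => ?_
  rw [abs_sub_comm]
  refine (abs_letterSum_sub_le (D i) host hχ (ha i hi) tA tB v).trans (Finset.sum_le_sum fun Z hZ => ?_)
  have hM : 0 ≤ M i Z := (abs_nonneg _).trans (ha i hi Z hZ v)
  exact mul_le_mul_of_nonneg_left (Finset.sum_le_sum fun l hl =>
    mul_le_mul_of_nonneg_left (hclose v hv i hi Z hZ l hl) (hχ l).L_pos.le) hM

end Ledger

/-! ## §5 The dichotomy, typed: a SHARP letter has no Lipschitz field; it needs the shell's share of the kernel's variation -/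

section Dichotomy

/-- **NO LIPSCHITZ FIELD FOR A SHARP LETTER.**  The sharp letter `t ↦ 1[t < 1]` (design (i); print's characteristic
functions, [Balaban1988Convergent] (2.17)) is NOT Lipschitz in the tested value for ANY constant (it jumps by `1` over
arbitrarily small gauges): `T4ActivityInterface`'s analytic field FAILS on sharp letter slots. [folklore] -/
theorem not_lipschitz_smallInd : ¬ ∃ Lc : ℝ, ∀ a b : ℝ, |smallInd a 1 - smallInd b 1| ≤ Lc * |a - b| := by
  rintro ⟨Lc, h⟩
  set ε : ℝ := 1 / (|Lc| + 2) with hε -- the jump `1` across the threshold would be `≤ Lc·ε < 1`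
  have hε0 : 0 < ε := by rw [hε]; positivity
  have h1 := h (1 - ε) 1
  have hsA : smallInd (1 - ε) 1 = 1 := by unfold smallInd; rw [if_pos (by linarith)]
  have hsB : smallInd (1 : ℝ) 1 = 0 := by unfold smallInd; rw [if_neg (lt_irrefl _)]
  rw [hsA, hsB, sub_zero, abs_one, show (1 - ε - 1 : ℝ) = -ε by ring, abs_neg, abs_of_pos hε0] at h1
  have h2 : Lc * ε ≤ |Lc| * ε := mul_le_mul_of_nonneg_right (le_abs_self _) hε0.le
  have h3 : |Lc| * ε < 1 := by
    rw [hε, mul_one_div, div_lt_one (by positivity)]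
    linarith [abs_nonneg Lc]
  linarith

variable {X : Type*} [MeasurableSpace X] {ν : Measure X}

/-- **WHAT A SHARP LETTER NEEDS INSIDE A SIGNED ACTIVITY: THE SHELL'S SHARE OF THE KERNEL'S VARIATION.**  With sharp
letters `1[u^X < θ]` and `|u^A − u^B| ≤ ρθ` a.e., the single-letter activities differ by at most the `|g|`-mass of run A's
two-sided shell `{(1−ρ)θ ≤ u^A < (1+ρ)θ}`; a bound `≤ s·∫|g|` therefore needs the HYPOTHESIS `∫_{shell}|g| ≤ s·∫|g|` — an
anti-concentration of `u^A` under the VARIATION `|g|dν` of a signed kernel ((M1)-species with no probability in sight).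
Typed as the conditional it is; NOT asserted, supplied by nobody. [folklore] -/
theorem abs_activity_sub_le_of_shellVariation {θ ρ s : ℝ} {uA uB : X → ℝ}
    (huA : Measurable uA) (huB : Measurable uB) {g : X → ℝ} (hg : Integrable g ν)
    (hclose : ∀ᵐ x ∂ν, |uA x - uB x| ≤ ρ * θ)
    (hshell : ∫ x, (smallInd (uA x) ((1 + ρ) * θ) * largeInd (uA x) ((1 - ρ) * θ)) * |g x| ∂ν ≤ s * ∫ x, |g x| ∂ν) :
    |(∫ x, smallInd (uA x) θ * g x ∂ν) - ∫ x, smallInd (uB x) θ * g x ∂ν| ≤ s * ∫ x, |g x| ∂ν := by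
  have hIA : Integrable (fun x => smallInd (uA x) θ * g x) ν :=
    integrable_unitInterval_mul hg (measurable_smallInd_comp huA θ) (fun x => smallInd_nonneg _ _)
      fun x => smallInd_le_one _ _
  have hIB : Integrable (fun x => smallInd (uB x) θ * g x) ν :=
    integrable_unitInterval_mul hg (measurable_smallInd_comp huB θ) (fun x => smallInd_nonneg _ _)
      fun x => smallInd_le_one _ _
  have hshm : Measurable fun x => smallInd (uA x) ((1 + ρ) * θ) * largeInd (uA x) ((1 - ρ) * θ) := by
    refine (measurable_smallInd_comp huA _).mul ?_
    unfold largeInd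
    exact Measurable.ite (measurableSet_le measurable_const huA) measurable_const measurable_const
  have hIS : Integrable (fun x => (smallInd (uA x) ((1 + ρ) * θ) * largeInd (uA x) ((1 - ρ) * θ)) * |g x|) ν := by
    refine integrable_unitInterval_mul hg.abs hshm (fun x => mul_nonneg (smallInd_nonneg _ _) ?_) fun x => ?_
    · unfold largeInd; split_ifs <;> norm_num
    · have h1 := smallInd_le_one (uA x) ((1 + ρ) * θ)
      have h2 : largeInd (uA x) ((1 - ρ) * θ) ≤ 1 := by unfold largeInd; split_ifs <;> norm_num
      have h3 : 0 ≤ largeInd (uA x) ((1 - ρ) * θ) := by unfold largeInd; split_ifs <;> norm_num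
      nlinarith [smallInd_nonneg (uA x) ((1 + ρ) * θ)]
  rw [← integral_sub hIA hIB]
  refine le_trans ?_ hshell
  calc |∫ x, (smallInd (uA x) θ * g x - smallInd (uB x) θ * g x) ∂ν|
      ≤ ∫ x, |smallInd (uA x) θ * g x - smallInd (uB x) θ * g x| ∂ν := abs_integral_le_integral_abs
    _ ≤ ∫ x, (smallInd (uA x) ((1 + ρ) * θ) * largeInd (uA x) ((1 - ρ) * θ)) * |g x| ∂ν := by
        refine integral_mono_ae (hIA.sub hIB).abs hIS ?_
        filter_upwards [hclose] with x hx
        rw [← sub_mul, abs_mul]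
        refine mul_le_mul_of_nonneg_right ?_ (abs_nonneg _)
        -- pointwise: the letters differ only on run A's two-sided shell
        have hx1 := (abs_sub_le_iff.1 hx).1
        have hx2 := (abs_sub_le_iff.1 hx).2
        unfold smallInd largeInd
        by_cases hA : uA x < θ <;> by_cases hB : uB x < θ <;> simp only [hA, hB, if_true, if_false, sub_self, abs_zero,
          sub_zero, zero_sub, abs_one, abs_neg]
        · positivity
        · -- uA < θ ≤ uB: uA ≥ uB − ρθ ≥ (1−ρ)θ and uA < θ ≤ (1+ρ)θ
          have h1 : uA x < (1 + ρ) * θ := by nlinarith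
          have h2 : (1 - ρ) * θ ≤ uA x := by nlinarith [not_lt.1 hB]
          rw [if_pos h1, if_pos h2, mul_one]
        · -- uB < θ ≤ uA: uA ≤ uB + ρθ < (1+ρ)θ and uA ≥ θ ≥ (1−ρ)θ
          have h1 : uA x < (1 + ρ) * θ := by nlinarith
          have h2 : (1 - ρ) * θ ≤ uA x := by nlinarith [not_lt.1 hA]
          rw [if_pos h1, if_pos h2, mul_one]
        · positivity

end Dichotomy

/-! ## §6 Sanity: the letter interface is inhabited with a NONZERO discrepancy inside the bound -/

section Sanity

/-- One polymer hosting ONE letter slot, profile `linProfile (1/2)` (`L̄ = 2`), amplitude `1`: run A's normalised tested value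
`1/2` (letter `1`), run B's `3/4` (letter `1/2`) — the activities DIFFER and the discrepancy `1/2` ATTAINS the interface bound
`L̄·|tA − tB|·M = 2·(1/4)·1`: the letter binders are jointly satisfiable with content. -/
example : ‖(1 : ℂ) * ((∏ _i ∈ ({()} : Finset Unit), linProfile (1 / 2) (1 / 2 : ℝ) : ℝ) : ℂ) -
      (1 : ℂ) * ((∏ _i ∈ ({()} : Finset Unit), linProfile (1 / 2) (3 / 4 : ℝ) : ℝ) : ℂ)‖ = 2 * |(1 / 2 : ℝ) - 3 / 4| * 1 := by
  have hA : linProfile (1 / 2) (1 / 2 : ℝ) = 1 := by norm_num [linProfile]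
  have hB : linProfile (1 / 2) (3 / 4 : ℝ) = 1 / 2 := by norm_num [linProfile]
  simp only [Finset.prod_const, Finset.card_singleton, pow_one, one_mul]
  rw [hA, hB, ← Complex.ofReal_sub, Complex.norm_real, Real.norm_eq_abs]
  norm_num [abs_of_neg]

end Sanity

end Summit.QuantumFields.BalabanUV.T4Continuum.NE7cSmoothingActivity

end
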